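import Summits.KontsevichZagierPeriods.KontsevichZagierPeriods.Theorems.ReductionTwoSix.Negative.Bookkeeping
import Summits.KontsevichZagierPeriods.KontsevichZagierPeriods.Theorems.ReductionTwoSix.Negative.NonVacuity

/-!
# `ReductionTwoSix` (stmt-KontsevichZagierPeriods-3871) — negative side V: the crux modulo its engine

Refuter (`cdisprove`) by-product, kernel-checked: LOAD-BEARING ANALYSIS in its sharpest form —

  `reductionTwoSix_of_dilationMove : DilationMove → IntegrableOn (1/(1−xy)) box → ReductionTwoSix`.

Item 3871 needs NOTHING beyond item 3872 (`DilationMove`, used at `n = 2` with `m = 2` (`S_dil2`),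
`m = 3` (`S_dil3`) and `m = k+1` (`S_dil_monomial`)), integrand additivity (`cls_add`), and the
integrability half of item 3875 (`BoxIntegralZetaTwo`). No Newton–Leibniz move, no domain additivity,
no change of dimension. The normal form is explicit: `P = (X⁶−1)·Q + R` (`deg R < 6`),
`a = −Σ_k Q_k/(k+1)²` (`polyConst`), `b = bCoeff p`, `c = cCoeff p` (`p r = R.coeff r`,
`Negative.Bookkeeping`), and the witness representation is the sector member `sectorRep (nfPoly a b c)`.
Only the `n = 2` slice `DilationMoveDim 2` is used (`reductionTwoSix_of_dilationMoveDim`). A prover closes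
3871 by `reductionTwoSix_of_dilationMove h3872 h3875.1`, or unconditionally via `BoxCoordinatePowerMap` +
`BoxIntegralZetaValues` (candidate proof `ReductionTwoSixProof.lean` attached to the item).
[Kontsevich–Zagier 2001 §1.2 rule (2); Milnor 1983; Lang 1990 Ch. 2 (distribution relations)]
-/

namespace Summit.KontsevichZagierPeriods.HurwitzMicroSectors.ReductionTwoSixNegative

open MeasureTheory Set
open Literature.NumberTheory.Transcendental
open Summit.KontsevichZagierPeriods.KontsevichZagierPeriods.Theses.HurwitzMicroSectors

noncomputable section

/-! ## §9 The crux modulo `DilationMove`: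
`DilationMove → IntegrableOn (1/(1−xy)) box → ReductionTwoSix`

LOAD-BEARING ANALYSIS in its sharpest form: the crux needs NOTHING beyond item DilationMove
(stmt-3872, used at `m = 2`, `m = 3` and `m = k+1`), integrand additivity, and the integrability
half of item BoxIntegralZetaTwo. No Newton–Leibniz move, no domain additivity, no dimension change. -/

section Relative

open Polynomial

/-- The group of formal combinations of representations modulo the KZ moves. -/
abbrev Q : Type := KZ.FormalRep ⧸ KZ.relations

/-- The class of a representation modulo the moves. -/
def cls {n : ℕ} (r : KZ.IntegralRep n) : Q := ((KZ.of r : KZ.FormalRep) : Q)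

/-- `KZ.Equivalent` is equality of classes. -/
theorem cls_eq_iff {n m : ℕ} {r : KZ.IntegralRep n} {r' : KZ.IntegralRep m} :
    cls r = cls r' ↔ KZ.Equivalent r r' := by
  unfold cls KZ.Equivalent
  rw [QuotientAddGroup.eq, ← sub_eq_neg_add, ← neg_sub (KZ.of r) (KZ.of r'), neg_mem_iff]

/-- Integrand additivity, read in the quotient. -/
theorem cls_add {n : ℕ} (r r₁ r₂ : KZ.IntegralRep n) (h₁ : r₁.domain = r.domain)
    (h₂ : r₂.domain = r.domain) (h : EqOn r.integrand (r₁.integrand + r₂.integrand) r.domain) :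
    cls r = cls r₁ + cls r₂ := by
  have hmem : KZ.of r - KZ.of r₁ - KZ.of r₂ ∈ KZ.relations :=
    KZ.integrandAddRel_subset_relations ⟨n, r, r₁, r₂, h₁, h₂, h, rfl⟩
  have h0 : ((KZ.of r - KZ.of r₁ - KZ.of r₂ : KZ.FormalRep) : Q) = 0 :=
    (QuotientAddGroup.eq_zero_iff _).mpr hmem
  rw [QuotientAddGroup.mk_sub, QuotientAddGroup.mk_sub, sub_sub, sub_eq_zero] at h0
  exact h0

/-- The zero representation on the domain of `r`. -/
def zeroRep {n : ℕ} (r : KZ.IntegralRep n) : KZ.IntegralRep n where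
  domain := r.domain
  integrand := 0
  isSemialgebraic_domain := r.isSemialgebraic_domain
  isSemialgebraicFunOn_integrand :=
    (isSemialgebraicFunOn_aeval r.isSemialgebraic_domain (0 : MvPolynomial (Fin n) ℚ)).congr
      (fun x _ => by simp)
  integrableOn := integrableOn_zero

/-- The zero representation is a relation. -/
theorem cls_zeroRep {n : ℕ} (r : KZ.IntegralRep n) : cls (zeroRep r) = 0 := by
  have h := cls_add (zeroRep r) (zeroRep r) (zeroRep r) rfl rfl (fun x _ => by simp [zeroRep])
  exact add_left_cancel (h.symm.trans (add_zero _).symm)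

/-- Two representations with the same domain and integrands agreeing on it have the same class. -/
theorem cls_congr {n : ℕ} (r r₁ : KZ.IntegralRep n) (h₁ : r₁.domain = r.domain)
    (h : EqOn r.integrand r₁.integrand r.domain) : cls r = cls r₁ := by
  have := cls_add r r₁ (zeroRep r) h₁ rfl (fun x hx => by
    simp only [Pi.add_apply, zeroRep, Pi.zero_apply, add_zero]; exact h hx)
  rwa [cls_zeroRep, add_zero] at this

/-- `DilationMove` restricted to ONE dimension `n` (the crux only needs `n = 2`). -/
def DilationMoveDim (n : ℕ) : Prop :=
  ∀ m : ℕ, 1 ≤ m → ∀ (r r' : KZ.IntegralRep n),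
    r.domain = {x | ∀ i, x i ∈ Set.Ioo (0:ℝ) 1} → r'.domain = {x | ∀ i, x i ∈ Set.Ioo (0:ℝ) 1} →
    (∀ x ∈ r.domain, r.integrand x = r'.integrand (fun i => x i ^ m) * ((m : ℝ) ^ n * ∏ i, x i ^ (m - 1))) →
    KZ.of r - KZ.of r' ∈ KZ.changeOfVariablesRel

/-- `DilationMove ↔ ∀ n, DilationMoveDim n` (definitional reshuffling). -/
theorem dilationMove_iff_forall_dim : DilationMove ↔ ∀ n, DilationMoveDim n :=
  ⟨fun h n m hm => h n m hm, fun h n m hm => h n m hm⟩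

variable (hI : IntegrableOn (fun x : Fin 2 → ℝ => 1 / (1 - x 0 * x 1)) box)

/-- Auxiliary: `sectorRep_domain`. -/
@[simp] theorem sectorRep_domain (P : ℚ[X]) : (sectorRep hI P).domain = box := rfl

/-- Auxiliary: `sectorRep_integrand`. -/
@[simp] theorem sectorRep_integrand (P : ℚ[X]) : (sectorRep hI P).integrand = sectorFun P := rfl

/-- Auxiliary: `sectorFun_add`. -/
theorem sectorFun_add (N₁ N₂ : ℚ[X]) (x : Fin 2 → ℝ) :
    sectorFun (N₁ + N₂) x = sectorFun N₁ x + sectorFun N₂ x := by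
  simp only [sectorFun, map_add, add_div]

/-- Auxiliary: `sectorFun_C_mul`. -/
theorem sectorFun_C_mul (q : ℚ) (N : ℚ[X]) (x : Fin 2 → ℝ) :
    sectorFun (C q * N) x = (q : ℝ) * sectorFun N x := by
  simp only [sectorFun, map_mul, Polynomial.aeval_C, eq_ratCast, mul_div_assoc]

/-- The sector map `N ↦ class of ∫_(0,1)² N(xy)/(1−(xy)⁶)`, an additive homomorphism `ℚ[X] →+ Q`
(integrand additivity). -/
def S : ℚ[X] →+ Q :=
  AddMonoidHom.mk' (fun N => cls (sectorRep hI N)) fun N₁ N₂ =>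
    cls_add _ _ _ rfl rfl fun x _ => by
      simp only [sectorRep_integrand, Pi.add_apply, sectorFun_add]

/-- Auxiliary: `S_apply`. -/
theorem S_apply (N : ℚ[X]) : S hI N = cls (sectorRep hI N) := rfl

/-- ONE dilation move between two sector members (from `DilationMove`, `n = 2`). -/
theorem S_dil (hD : DilationMoveDim 2) (m : ℕ) (hm : 1 ≤ m) (N N' : ℚ[X])
    (h : ∀ x ∈ box, sectorFun N x =
      sectorFun N' (fun i => x i ^ m) * ((m : ℝ) ^ 2 * ∏ i, x i ^ (m - 1))) :
    S hI N = S hI N' := by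
  have hmem := KZ.changeOfVariablesRel_subset_relations
    (hD m hm (sectorRep hI N) (sectorRep hI N') rfl rfl h)
  rw [S_apply, S_apply, cls, cls, ← sub_eq_zero, ← QuotientAddGroup.mk_sub]
  exact (QuotientAddGroup.eq_zero_iff _).mpr hmem

/-- Auxiliary: `t_pow_lt_one`. -/
theorem t_pow_lt_one {x : Fin 2 → ℝ} (hx : x ∈ box) {n : ℕ} (hn : n ≠ 0) : (x 0 * x 1) ^ n < 1 :=
  pow_lt_one₀ (t_pos hx).le (t_lt_one hx) hn

/-- `Dil₂`: `[4q·t^(2r+1)/(1−t⁶)] = [q·t^r/(1−t³)] = [q·t^r(1+t³)/(1−t⁶)]`. -/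
theorem S_dil2 (hD : DilationMoveDim 2) (q : ℚ) (r : ℕ) :
    S hI (C (4 * q) * X ^ (2 * r + 1)) = S hI (C q * X ^ r * (1 + X ^ 3)) := by
  refine S_dil hI hD 2 (by norm_num) _ _ fun x hx => ?_
  have h6 := one_sub_t6_ne hx
  have h12 : 1 - (x 0 * x 1) ^ 12 ≠ 0 := (sub_pos.mpr (t_pow_lt_one hx (by norm_num))).ne'
  have hp6 : 1 + (x 0 * x 1) ^ 6 ≠ 0 := by have := t_pos hx; positivity
  simp only [sectorFun, map_mul, map_pow, map_add, map_one, Polynomial.aeval_C,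
    Polynomial.aeval_X, eq_ratCast, Fin.prod_univ_two]
  rw [show (x 0 ^ 2 * x 1 ^ 2) = (x 0 * x 1) ^ 2 by ring,
    show x 0 ^ (2 - 1) * x 1 ^ (2 - 1) = x 0 * x 1 by norm_num]
  generalize x 0 * x 1 = t at h6 h12 hp6 ⊢
  push_cast
  rw [div_mul_eq_mul_div, div_eq_div_iff h6 (by rw [← pow_mul]; exact h12)]
  rw [← pow_mul, ← pow_mul]
  have : (1 : ℝ) - t ^ (2 * 6) = (1 - t ^ 6) * (1 + t ^ 6) := by ring
  rw [this]
  ring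

/-- `Dil₃`: `[9q·t^(3r+2)/(1−t⁶)] = [q·t^r/(1−t²)] = [q·t^r(1+t²+t⁴)/(1−t⁶)]`. -/
theorem S_dil3 (hD : DilationMoveDim 2) (q : ℚ) (r : ℕ) :
    S hI (C (9 * q) * X ^ (3 * r + 2)) = S hI (C q * X ^ r * (1 + X ^ 2 + X ^ 4)) := by
  refine S_dil hI hD 3 (by norm_num) _ _ fun x hx => ?_
  have h6 := one_sub_t6_ne hx
  have h18 : 1 - (x 0 * x 1) ^ 18 ≠ 0 := (sub_pos.mpr (t_pow_lt_one hx (by norm_num))).ne'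
  simp only [sectorFun, map_mul, map_pow, map_add, map_one, Polynomial.aeval_C,
    Polynomial.aeval_X, eq_ratCast, Fin.prod_univ_two]
  rw [show (x 0 ^ 3 * x 1 ^ 3) = (x 0 * x 1) ^ 3 by ring,
    show x 0 ^ (3 - 1) * x 1 ^ (3 - 1) = (x 0 * x 1) ^ 2 by norm_num [mul_pow]]
  generalize x 0 * x 1 = t at h6 h18 ⊢
  push_cast
  rw [div_mul_eq_mul_div, div_eq_div_iff h6 (by rw [← pow_mul]; exact h18)]
  rw [← pow_mul, ← pow_mul, ← pow_mul]
  have : (1 : ℝ) - t ^ (3 * 6) = (1 - t ^ 6) * (1 + t ^ 6 + t ^ 12) := by ring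
  rw [this]
  ring

/-- `Dil_{k+1}` on a constant: `[q(k+1)²·t^k] = [q]` — the polynomial part needs no Newton–Leibniz. -/
theorem S_dil_monomial (hD : DilationMoveDim 2) (q : ℚ) (k : ℕ) :
    S hI (C (q * ((k : ℚ) + 1) ^ 2) * X ^ k * (1 - X ^ 6)) = S hI (C q * (1 - X ^ 6)) := by
  refine S_dil hI hD (k + 1) (Nat.succ_le_succ (Nat.zero_le k)) _ _ fun x hx => ?_
  have h6 := one_sub_t6_ne hx
  have hk6 : 1 - ((x 0 * x 1) ^ (k + 1)) ^ 6 ≠ 0 := by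
    rw [← pow_mul]; exact (sub_pos.mpr (t_pow_lt_one hx (by positivity))).ne'
  simp only [sectorFun, map_mul, map_pow, map_sub, map_add, map_one, Polynomial.aeval_C,
    Polynomial.aeval_X, eq_ratCast, Fin.prod_univ_two, Nat.add_sub_cancel]
  rw [show (x 0 ^ (k + 1) * x 1 ^ (k + 1)) = (x 0 * x 1) ^ (k + 1) by rw [mul_pow],
    show x 0 ^ k * x 1 ^ k = (x 0 * x 1) ^ k by rw [mul_pow]]
  generalize x 0 * x 1 = t at h6 hk6 ⊢
  push_cast
  rw [mul_div_assoc, div_self h6, mul_one, mul_div_assoc, div_self hk6, mul_one]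
  ring

/-- `φ r q = S (q·X^r)`: the six level-6 residue classes as additive families. -/
def phi (r : Fin 6) : ℚ →+ Q := (S hI).comp (Polynomial.monomial (r : ℕ)).toAddMonoidHom

/-- Auxiliary: `phi_apply`. -/
theorem phi_apply (r : Fin 6) (q : ℚ) : phi hI r q = S hI (C q * X ^ (r : ℕ)) := by
  simp [phi, Polynomial.C_mul_X_pow_eq_monomial]

/-- Auxiliary: `S_congr_poly`. -/
theorem S_congr_poly {N N' : ℚ[X]} (h : N = N') : S hI N = S hI N' := by rw [h]

/-- The four dilation hypotheses of `bookkeeping` hold for `phi` (given `DilationMove`). -/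
theorem phi_dil2_0 (hD : DilationMoveDim 2) (q : ℚ) : phi hI 1 (4 * q) = phi hI 0 q + phi hI 3 q := by
  rw [phi_apply, phi_apply, phi_apply, ← map_add]
  have h := S_dil2 hI hD q 0
  refine (S_congr_poly hI ?_).trans (h.trans (S_congr_poly hI ?_))
  · simp
  · simp; ring

/-- Auxiliary: `phi_dil2_1`. -/
theorem phi_dil2_1 (hD : DilationMoveDim 2) (q : ℚ) : phi hI 3 (4 * q) = phi hI 1 q + phi hI 4 q := by
  rw [phi_apply, phi_apply, phi_apply, ← map_add]
  have h := S_dil2 hI hD q 1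
  refine (S_congr_poly hI ?_).trans (h.trans (S_congr_poly hI ?_))
  · simp
  · simp; ring

/-- Auxiliary: `phi_dil2_2`. -/
theorem phi_dil2_2 (hD : DilationMoveDim 2) (q : ℚ) : phi hI 5 (4 * q) = phi hI 2 q + phi hI 5 q := by
  rw [phi_apply, phi_apply, phi_apply, ← map_add]
  have h := S_dil2 hI hD q 2
  refine (S_congr_poly hI ?_).trans (h.trans (S_congr_poly hI ?_))
  · simp
  · simp; ring

/-- Auxiliary: `phi_dil3_1`. -/
theorem phi_dil3_1 (hD : DilationMoveDim 2) (q : ℚ) :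
    phi hI 5 (9 * q) = phi hI 1 q + phi hI 3 q + phi hI 5 q := by
  rw [phi_apply, phi_apply, phi_apply, phi_apply, ← map_add, ← map_add]
  have h := S_dil3 hI hD q 1
  refine (S_congr_poly hI ?_).trans (h.trans (S_congr_poly hI ?_))
  · simp
  · simp; ring

end Relative

section Assembly

open Polynomial

variable (hI : IntegrableOn (fun x : Fin 2 → ℝ => 1 / (1 - x 0 * x 1)) box)

/-- The monic `X⁶ − 1`. -/
def q6 : ℚ[X] := X ^ 6 - C 1

/-- Auxiliary: `q6_monic`. -/
theorem q6_monic : q6.Monic := Polynomial.monic_X_pow_sub_C (1 : ℚ) (by norm_num)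

/-- Auxiliary: `natDegree_q6`. -/
theorem natDegree_q6 : q6.natDegree = 6 := by
  unfold q6; exact Polynomial.natDegree_X_pow_sub_C

/-- Auxiliary: `q6_ne_one`. -/
theorem q6_ne_one : q6 ≠ 1 := fun h => by
  have := congrArg Polynomial.natDegree h
  rw [natDegree_q6, Polynomial.natDegree_one] at this
  exact absurd this (by norm_num)

/-- The constant produced by the polynomial part: `a₀(Q) = Σ_k Q_k/(k+1)²` (`∬(xy)^k = (k+1)⁻²`). -/
def polyConst (Qt : ℚ[X]) : ℚ :=
  ∑ k ∈ Finset.range (Qt.natDegree + 1), Qt.coeff k / ((k : ℚ) + 1) ^ 2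

/-- POLYNOMIAL PART by dilations only: `S ((X⁶−1)·Q) = S (C(−a₀(Q))·(1−X⁶))`. -/
theorem S_q6_mul (hD : DilationMoveDim 2) (Qt : ℚ[X]) :
    S hI (q6 * Qt) = S hI (C (-polyConst Qt) * (1 - X ^ 6)) := by
  conv_lhs => rw [Qt.as_sum_range_C_mul_X_pow, Finset.mul_sum, map_sum]
  have hk : ∀ k ∈ Finset.range (Qt.natDegree + 1),
      S hI (q6 * (C (Qt.coeff k) * X ^ k)) =
        S hI (C (-(Qt.coeff k / ((k : ℚ) + 1) ^ 2)) * (1 - X ^ 6)) := by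
    intro k _
    have hk1 : ((k : ℚ) + 1) ^ 2 ≠ 0 := by positivity
    have e1 : q6 * (C (Qt.coeff k) * X ^ k) =
        -(C (Qt.coeff k / ((k : ℚ) + 1) ^ 2 * ((k : ℚ) + 1) ^ 2) * X ^ k * (1 - X ^ 6)) := by
      rw [div_mul_cancel₀ _ hk1]; unfold q6; simp only [map_one]; ring
    rw [e1, map_neg, S_dil_monomial hI hD, ← map_neg, ← neg_mul, ← Polynomial.C_neg]
  rw [Finset.sum_congr rfl hk, ← map_sum, ← Finset.sum_mul, ← map_sum, polyConst,
    ← Finset.sum_neg_distrib]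

/-- LEVEL-6 PART: for `deg R < 6`, `S R = S (C b·(1+X+…+X⁵) + C c·(1−X+X³−X⁴))` with the
`bookkeeping` coefficients of `p r = R.coeff r`. -/
theorem S_lowDegree (hD : DilationMoveDim 2) (R : ℚ[X]) (hR : R.natDegree < 6) :
    S hI R = S hI (C (bCoeff fun r : Fin 6 => R.coeff r) * (1 + X + X ^ 2 + X ^ 3 + X ^ 4 + X ^ 5) +
      C (cCoeff fun r : Fin 6 => R.coeff r) * (1 - X + X ^ 3 - X ^ 4)) := by
  set p : Fin 6 → ℚ := fun r => R.coeff r with hp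
  have h1 : S hI R = ∑ r : Fin 6, phi hI r (p r) := by
    conv_lhs => rw [R.as_sum_range_C_mul_X_pow' hR, map_sum]
    rw [← Fin.sum_univ_eq_sum_range]
    refine Finset.sum_congr rfl fun r _ => ?_
    rw [phi_apply]
  rw [h1, bookkeeping (phi hI) (phi_dil2_0 hI hD) (phi_dil2_1 hI hD) (phi_dil2_2 hI hD)
    (phi_dil3_1 hI hD) p]
  simp only [Fin.sum_univ_six, phi_apply, ← map_add, ← map_sub]
  congr 1
  simp only [Fin.val_zero, Fin.val_one, Fin.val_two, show ((3 : Fin 6) : ℕ) = 3 from rfl,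
    show ((4 : Fin 6) : ℕ) = 4 from rfl, show ((5 : Fin 6) : ℕ) = 5 from rfl]
  ring

/-- Auxiliary: `sectorFun_oneSubX6`. -/
theorem sectorFun_oneSubX6 {x : Fin 2 → ℝ} (hx : x ∈ box) : sectorFun (1 - X ^ 6) x = 1 := by
  have h6 := one_sub_t6_ne hx
  simp only [sectorFun, map_sub, map_one, map_pow, Polynomial.aeval_X]
  exact div_self h6

/-- Auxiliary: `sectorFun_pole`. -/
theorem sectorFun_pole {x : Fin 2 → ℝ} (hx : x ∈ box) :
    sectorFun (1 + X + X ^ 2 + X ^ 3 + X ^ 4 + X ^ 5) x = 1 / (1 - x 0 * x 1) := by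
  have h6 := one_sub_t6_ne hx
  have h1 := one_sub_t_ne hx
  simp only [sectorFun, map_add, map_one, map_pow, Polynomial.aeval_X]
  generalize x 0 * x 1 = t at h1 h6 ⊢
  rw [div_eq_div_iff h6 h1]
  ring

/-- Auxiliary: `sectorFun_cubic`. -/
theorem sectorFun_cubic {x : Fin 2 → ℝ} (hx : x ∈ box) :
    sectorFun (1 - X + X ^ 3 - X ^ 4) x = 1 / (1 + x 0 * x 1 + (x 0 * x 1) ^ 2) := by
  have h6 := one_sub_t6_ne hx
  have h2 := cubic_ne hx
  simp only [sectorFun, map_add, map_sub, map_one, map_pow, Polynomial.aeval_X]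
  generalize x 0 * x 1 = t at h2 h6 ⊢
  rw [div_eq_div_iff h6 h2]
  ring

/-- The normal-form member of the sector. -/
def nfPoly (a b c : ℚ) : ℚ[X] :=
  C a * (1 - X ^ 6) + C b * (1 + X + X ^ 2 + X ^ 3 + X ^ 4 + X ^ 5) + C c * (1 - X + X ^ 3 - X ^ 4)

/-- Auxiliary: `sectorFun_nfPoly`. -/
theorem sectorFun_nfPoly (a b c : ℚ) {x : Fin 2 → ℝ} (hx : x ∈ box) :
    sectorFun (nfPoly a b c) x =
      (a : ℝ) + b / (1 - x 0 * x 1) + c / (1 + x 0 * x 1 + (x 0 * x 1) ^ 2) := by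
  simp only [nfPoly, sectorFun_add, sectorFun_C_mul, sectorFun_oneSubX6 hx, sectorFun_pole hx,
    sectorFun_cubic hx]
  ring

/-- **The crux modulo its engine.** `DilationMove` (item stmt-3872) and the integrability of
`1/(1−xy)` on the open box (half of item BoxIntegralZetaTwo) imply `ReductionTwoSix`, with the
EXPLICIT normal form `a = −Σ_k Q_k/(k+1)²`, `b = bCoeff p`, `c = cCoeff p` where
`P = (X⁶−1)·Q + R`, `deg R < 6`, `p r = R.coeff r`; the witness `r'` is the sector member
`sectorRep (nfPoly a b c)` itself. Moves used: integrand additivity and the dilations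
`m = 2, 3` (level-6 relations) and `m = k+1` (monomials) — nothing else. -/
theorem reductionTwoSix_of_dilationMoveDim (hD : DilationMoveDim 2)
    (hI : IntegrableOn (fun x : Fin 2 → ℝ => 1 / (1 - x 0 * x 1)) box) : ReductionTwoSix := by
  intro r P hdom hint
  obtain ⟨R, hRdef⟩ : ∃ R : ℚ[X], R = P %ₘ q6 := ⟨_, rfl⟩
  obtain ⟨Qt, hQdef⟩ : ∃ Qt : ℚ[X], Qt = P /ₘ q6 := ⟨_, rfl⟩
  have hP : P = R + q6 * Qt := by rw [hRdef, hQdef, Polynomial.modByMonic_add_div]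
  have hR : R.natDegree < 6 := by
    rw [hRdef, ← natDegree_q6]; exact Polynomial.natDegree_modByMonic_lt P q6_monic q6_ne_one
  refine ⟨-polyConst Qt, bCoeff fun i : Fin 6 => R.coeff i, cCoeff fun i : Fin 6 => R.coeff i,
    sectorRep hI (nfPoly (-polyConst Qt) (bCoeff fun i : Fin 6 => R.coeff i)
      (cCoeff fun i : Fin 6 => R.coeff i)), rfl, fun x hx => sectorFun_nfPoly _ _ _ hx, ?_⟩
  rw [← cls_eq_iff]
  have h1 : cls r = S hI P :=
    cls_congr r (sectorRep hI P) (by rw [hdom]; rfl) hint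
  rw [h1, hP, map_add, S_q6_mul hI hD Qt, S_lowDegree hI hD R hR, ← map_add]
  show S hI _ = S hI _
  congr 1
  unfold nfPoly
  ring

/-- **The crux modulo its engine** (route form): `DilationMove → IntegrableOn (1/(1−xy)) box →
ReductionTwoSix`; only the `n = 2` dilations are used (`reductionTwoSix_of_dilationMoveDim`). -/
theorem reductionTwoSix_of_dilationMove (hD : DilationMove)
    (hI : IntegrableOn (fun x : Fin 2 → ℝ => 1 / (1 - x 0 * x 1)) box) : ReductionTwoSix :=
  reductionTwoSix_of_dilationMoveDim (dilationMove_iff_forall_dim.mp hD 2) hI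

/- For a PROVER (refuters do not land proofs of route items): with the route's own support item,
`example (hD : DilationMove) (hZ : BoxIntegralZetaTwo) : ReductionTwoSix :=
  reductionTwoSix_of_dilationMove hD hZ.1`; unconditionally, `DilationMoveDim 2` follows in ten lines
from `Literature/NumberTheory/Transcendental/BoxCoordinatePowerMap.lean` and the integrability
hypothesis is `box_integral_one_div_one_sub_mul_two.1` (`BoxIntegralZetaValues.lean`) — see the
candidate proof `ReductionTwoSixProof.lean` attached to item stmt-KontsevichZagierPeriods-3871. -/

end Assembly

end

end Summit.KontsevichZagierPeriods.HurwitzMicroSectors.ReductionTwoSixNegative
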